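import Summits.CriticalPhenomena.Ising3DConformalLimit.Theorems.InverseSquareTelemetryTwoPointSpineComplementAnatomy
import Summits.CriticalPhenomena.Ising3DConformalLimit.Theorems.PrecisionLaplacianMoebiusLimitOfTwoPointLawBareFactorisation
import Summits.CriticalPhenomena.Ising3DConformalLimit.Theorems.GaussianScaleMixtureRotationUpgradeFromTwoPoint
import HarnessLib

/-!
# Crux `InverseSquareTelemetry.TwoPointSpineComplement` (stmt-CriticalPhenomena-4497): the EXACT SPLIT onto the three
# home items 4738 / 1982 / 0636, with the glue proved (lead c3; `--supports stmt-CriticalPhenomena-4497`)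

THEOREM-ONLY helper file (no definition, no named fact, no `sorry`). Organisational, for the planners of route
`InverseSquareTelemetry` (cf. the strategists' `SPLIT-PACKAGE*.md` of crux stmt-4801, 2026-08-17): since cruxes stmt-8367
(`rotationUpgradeFromTwoPoint_proof`), stmt-1980 and stmt-1979 are PROVED, the crux (C) is EXACTLY the conjunction, under
the two-point law (item 0634), of three EXISTING staffed items with their own crux chains —

* item stmt-CriticalPhenomena-4738 `WeylWindow.LimitExists` (bare existence of a non-degenerate pointwise limit),
* item stmt-CriticalPhenomena-1982 `HyperoctahedralRP.InversionUpgradeNormalised` (unit-inversion covariance of every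
  normalised non-degenerate Euclidean scale-covariant limit),
* item stmt-CriticalPhenomena-0636 `IsingEuclidUpgradeR4NonGaussian` (every non-degenerate limit has `U₄ ≢ 0`; here in
  its `PrecisionLaplacian` copy, definitionally the `IsingEuclidUpgrade` one) —

so that a `route edit --split TwoPointSpineComplement` onto these children can cite the glue BY NAME:

* `TwoPointSpineComplement_of_subs : LimitExists → InversionUpgradeNormalised → IsingEuclidUpgradeR4NonGaussian → (C)`
  (registered bookkeeping stub; header on one line) — `moebiusLimitOfTwoPointLaw_of_bare₂` (p116785) with the proved 8367
  gives item 4801, and `twoPointSpineComplement_iff_moebius_and_nonGaussian` (p146538) finishes;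
* `twoPointSpineComplement_iff_subs : (C) ↔ (0634 → 4738 ∧ 1982 ∧ 0636)` — exactness (each child necessary given 0634:
  `Anatomy.limitExists_of_twoPointSpineComplement`, `inversionUpgradeNormalised_of_crux`,
  `Anatomy.nonGaussian_of_twoPointSpineComplement`).

Nothing here is new mathematics; the two genuinely open masses are existence (4738) + conformal covariance (1982) and
non-Gaussianity (0636) of the critical `ℤ³` scaling limit (Duminil-Copin, ICM 2022, §8.4).
-/

noncomputable section

namespace Summit.CriticalPhenomena.Ising3DConformalLimit.InverseSquareTelemetryTwoPointSpineComplement.Split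

open Literature.Probability.LatticeModels Filter Topology
open Summit.CriticalPhenomena.Ising3DConformalLimit.Theses
open Summit.CriticalPhenomena.Ising3DConformalLimit.Theses.InverseSquareTelemetry
  (TwoPointSpineComplement IsingEuclidUpgradeR2RotInvPowerLaw)
open Summit.CriticalPhenomena.Ising3DConformalLimit.Theses.PrecisionLaplacian
  (MoebiusLimitOfTwoPointLaw IsingEuclidUpgradeR4NonGaussian)
open Summit.CriticalPhenomena.Ising3DConformalLimit.PrecisionLaplacianMoebiusLimitOfTwoPointLaw
  (moebiusLimitOfTwoPointLaw_of_bare₂ moebiusLimitOfTwoPointLaw_iff_bare₂)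
open Summit.CriticalPhenomena.Ising3DConformalLimit.Cruxes.RotationUpgradeFromTwoPoint.NullLaplacianEdgeGaussianity
  (rotationUpgradeFromTwoPoint_proof)
open Summit.CriticalPhenomena.Ising3DConformalLimit.InverseSquareTelemetryTwoPointSpineComplement.Anatomy
  (twoPointSpineComplement_iff_moebius_and_nonGaussian moebiusLimitOfTwoPointLaw_of_twoPointSpineComplement
    nonGaussian_of_twoPointSpineComplement)

/-- **Glue of the exact split (registered bookkeeping stub; header on one line).** Items 4738 → 1982 → 0636 → (C):
bare existence and the inversion upgrade give item 4801 through `moebiusLimitOfTwoPointLaw_of_bare₂` (the `O(3)` step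
being the PROVED crux stmt-8367 `rotationUpgradeFromTwoPoint_proof`), and (C) ↔ 4801 ∧ (0634 → 0636)
(`twoPointSpineComplement_iff_moebius_and_nonGaussian`). [cite: DuminilCopinICM2022, §8.4 p. 29] -/
theorem TwoPointSpineComplement_of_subs : Summit.CriticalPhenomena.Ising3DConformalLimit.Theses.WeylWindow.LimitExists → Summit.CriticalPhenomena.Ising3DConformalLimit.Theses.HyperoctahedralRP.InversionUpgradeNormalised → Summit.CriticalPhenomena.Ising3DConformalLimit.Theses.PrecisionLaplacian.IsingEuclidUpgradeR4NonGaussian → Summit.CriticalPhenomena.Ising3DConformalLimit.Theses.InverseSquareTelemetry.TwoPointSpineComplement :=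
  fun hL hI hN => twoPointSpineComplement_iff_moebius_and_nonGaussian.2
    ⟨moebiusLimitOfTwoPointLaw_of_bare₂ hL rotationUpgradeFromTwoPoint_proof hI, fun _ => hN⟩

/-- **Exactness of the split: (C) ↔ (item 0634 → items 4738 ∧ 1982 ∧ 0636).** `→`: (C) gives 4801
(`moebiusLimitOfTwoPointLaw_of_twoPointSpineComplement`), whose exact residue under 0634 is 4738 ∧ 8367 ∧ 1982
(`moebiusLimitOfTwoPointLaw_iff_bare₂`), and (0634 → 0636) by transfer (`nonGaussian_of_twoPointSpineComplement`);
`←`: under a law witness the three children and `TwoPointSpineComplement_of_subs`. [cite: DuminilCopinICM2022, §8.4 p. 29] -/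
theorem twoPointSpineComplement_iff_subs :
    TwoPointSpineComplement ↔
      (IsingEuclidUpgradeR2RotInvPowerLaw →
        WeylWindow.LimitExists ∧ HyperoctahedralRP.InversionUpgradeNormalised ∧ IsingEuclidUpgradeR4NonGaussian) := by
  constructor
  · intro h hP
    have h4801 : MoebiusLimitOfTwoPointLaw := moebiusLimitOfTwoPointLaw_of_twoPointSpineComplement h
    obtain ⟨hL, -, hI⟩ := moebiusLimitOfTwoPointLaw_iff_bare₂.1 h4801 hP
    exact ⟨hL, hI, nonGaussian_of_twoPointSpineComplement h hP⟩
  · intro h Δ c hc hP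
    obtain ⟨hL, hI, hN⟩ := h ⟨Δ, c, hc, hP⟩
    exact TwoPointSpineComplement_of_subs hL hI hN Δ c hc hP

/-- The child 1982 is necessary given item 0634 (the other two necessities are the landed
`Anatomy.limitExists_of_twoPointSpineComplement` / `Anatomy.nonGaussian_of_twoPointSpineComplement`). [folklore] -/
theorem inversionUpgradeNormalised_of_crux (h : TwoPointSpineComplement) (hP : IsingEuclidUpgradeR2RotInvPowerLaw) :
    HyperoctahedralRP.InversionUpgradeNormalised :=
  (twoPointSpineComplement_iff_subs.1 h hP).2.1

end Summit.CriticalPhenomena.Ising3DConformalLimit.InverseSquareTelemetryTwoPointSpineComplement.Split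

end
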